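import Literature.NumberTheory.Transcendental.Waldschmidt1980KStep
import HarnessLib

/-!
# Waldschmidt 1980, Lemmas 3.5–3.7 over `ℚ` with a LARGE interpolation radius (`R = 64 r`)

Support file (theorems only; no definitions, no named facts) for the archimedean input of the
Stewart–Yu 1991 line of `Literature.Barriers.ABC.stewartYu1991_upperBound` (M. Waldschmidt,
*A lower bound for linear forms in logarithms*, Acta Arith. **37** (1980), Prop. 3.8 over `ℚ`,
`q = 2`); sequel to `Waldschmidt1980KStep.lean`.

Waldschmidt applies the interpolation Lemma 2.3 with `R = 4E₁ r` (p. 271), i.e. with a LARGE ratio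
`R/r`, so that each zero of multiplicity `t` gains a factor `E₁^{-t}`; the tree's
`CW77.hermite_integer_points` has the fixed ratio `R = 6k` (gain `(3/5)^{kt}`), which is enough for
Cijsouw–Waldschmidt but leaves little room in Waldschmidt's bookkeeping. This file repeats the
three statements of `Waldschmidt1980KStep.lean` with the radius `64 k` (gain `(1/21)^{kt}`,
growth hypotheses on `|z| ≤ 65 SK`):

* `hermite_integer_points_far` — `|f(w)| ≤ 2 k^{t+1} t (28e)^{kt} ε + B_f (1/21)^{kt}` (`|w| ≤ 2k`,
  `|f| ≤ B_f` on `|z| = 64k`);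
* `w80_norm_Φ_le_of_odd_zeros_far`, `w80_kstep_far`, `w80_halfstep_far` — Lemmas 3.5, 3.6, 3.7
  as before, with `7 SK ↦ 65 SK` and `(3/5) ↦ (1/21)`.

## References

* [Waldschmidt1980] M. Waldschmidt, *A lower bound for linear forms in logarithms*, Acta Arith. 37
  (1980), 257–283 — Lemma 2.3 (p. 261), Lemmas 3.5–3.7 (pp. 270–272).
* [CijsouwWaldschmidt1977] P. L. Cijsouw, M. Waldschmidt, Compositio Math. 34 (1977) — Lemma 2
  (the tree's `CW77.hermite_integer_points`, whose proof is repeated with the new radius).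
-/

noncomputable section

open Complex Finset Polynomial
open Literature.NumberTheory.Transcendental.Baker1975
open Literature.NumberTheory.Transcendental.Baker1975.Ch3

namespace Literature.NumberTheory.Transcendental.CW77

/-- **Cijsouw–Waldschmidt's Lemma 2 for integer points, far version** (`δ = 1`, radii `r = k`,
`2k`, `64k`): if `f` is entire, `|f^{(σ)}(i)| ≤ ε` for all integers `0 ≤ i < k` and `σ < t`
(`k, t ≥ 1`), and `|f| ≤ B_f` on `|z| = 64k`, then
`|f(w)| ≤ 2 k^{t+1} t (28e)^{kt} ε + B_f (1/21)^{kt}` for `|w| ≤ 2k` (the tree's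
`CW77.hermite_integer_points` is the radius `6k`, ratio `3/5`; Waldschmidt takes `R = 4E₁r` in
Lemma 3.5 — a large ratio is what the `k`-extrapolation of Lemma 3.6 lives on).
[cite: Waldschmidt1980, Lemma 2.3 (p. 261) and Lemma 3.5 (p. 271)] -/
theorem hermite_integer_points_far {f : ℂ → ℂ} (hf : Differentiable ℂ f) {k t : ℕ} (hk : 1 ≤ k)
    (ht : 1 ≤ t) {ε Bf : ℝ} (hε : 0 ≤ ε)
    (hsmall : ∀ i : ℕ, i < k → ∀ σ, σ < t → ‖iteratedDeriv σ f (i : ℂ)‖ ≤ ε)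
    (hB : ∀ z ∈ Metric.sphere (0 : ℂ) (64 * k), ‖f z‖ ≤ Bf) {w : ℂ} (hw : ‖w‖ ≤ 2 * k) :
    ‖f w‖ ≤ 2 * (k : ℝ) ^ (t + 1) * t * (28 * Real.exp 1) ^ (k * t) * ε + Bf * (1 / 21) ^ (k * t) := by
  classical
  set E : Finset ℂ := (range k).image (fun j : ℕ => (j : ℂ)) with hE
  have hinj : Function.Injective (fun j : ℕ => (j : ℂ)) := Nat.cast_injective
  have hcard : E.card = k := by rw [hE, card_image_of_injective _ hinj, card_range]
  set Λ₀ : ℝ := (k - 1).factorial / 2 ^ (k - 1) with hΛ₀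
  have hΛ₀pos : 0 < Λ₀ := by rw [hΛ₀]; positivity
  have hk1 : (1 : ℝ) ≤ k := by exact_mod_cast hk
  have hk0 : (0 : ℝ) < k := by linarith
  -- hypotheses of the Hermite estimate
  have hEr : ∀ e ∈ E, ‖e‖ ≤ (k : ℝ) := by
    intro e he
    obtain ⟨j, hj, rfl⟩ := mem_image.mp he
    rw [Complex.norm_natCast]
    exact_mod_cast (mem_range.mp hj).le
  have hsep : ∀ e₁ ∈ E, ∀ e₂ ∈ E, e₁ ≠ e₂ → (1 : ℝ) ≤ ‖e₁ - e₂‖ := by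
    intro e₁ he₁ e₂ he₂ hne
    obtain ⟨j₁, _, rfl⟩ := mem_image.mp he₁
    obtain ⟨j₂, _, rfl⟩ := mem_image.mp he₂
    have hne' : j₁ ≠ j₂ := fun h => hne (by rw [h])
    rw [← Complex.ofReal_natCast, ← Complex.ofReal_natCast, ← Complex.ofReal_sub, Complex.norm_real,
      Real.norm_eq_abs, ← Int.cast_natCast, ← Int.cast_natCast (R := ℝ) j₂, ← Int.cast_sub,
      ← Int.cast_abs]
    have : (1 : ℤ) ≤ |(j₁ : ℤ) - j₂| := Int.one_le_abs (sub_ne_zero.mpr (by exact_mod_cast hne'))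
    exact_mod_cast this
  have hprod : ∀ e ∈ E, Λ₀ ≤ ∏ e' ∈ E.erase e, ‖e - e'‖ := by
    intro e he
    obtain ⟨i, hi, rfl⟩ := mem_image.mp he
    have hi' := mem_range.mp hi
    rw [hE, prod_norm_sub_natCast hi', hΛ₀, div_le_iff₀ (by positivity)]
    have := factorial_le_two_pow_mul (show i ≤ k - 1 by omega)
    have hki : k - 1 - i = (k - 1) - i := rfl
    calc ((k - 1).factorial : ℝ) ≤ 2 ^ (k - 1) * (i.factorial * ((k - 1) - i).factorial) := this
      _ = (i.factorial : ℝ) * (k - 1 - i).factorial * 2 ^ (k - 1) := by ring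
  have hsmall' : ∀ e ∈ E, ∀ σ < t, ‖iteratedDeriv σ f e‖ ≤ ε := by
    intro e he σ hσ
    obtain ⟨i, hi, rfl⟩ := mem_image.mp he
    exact hsmall i (mem_range.mp hi) σ hσ
  have key := Hermite.norm_le_of_small_jets hf E t (r := k) (R := 64 * k) (ρ := 2 * k) (δ := 1)
    hk1 (by positivity) (by linarith) (by linarith) one_pos le_rfl hΛ₀pos hε hEr hsep hprod hsmall' hB hw
  rw [hcard] at key
  -- simplify the two terms
  have h2δ : ((2 : ℝ) / 1) ^ t = 2 ^ t := by rw [div_one]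
  rw [h2δ] at key
  have hratio : ((2 * (k : ℝ) + k) / (64 * k - k)) = 1 / 21 := by
    field_simp; ring
  rw [hratio] at key
  -- the factor `(c k)^{tk} 2^t / Λ₀^t ≤ k^t (2ce)^{kt}` for `c = 6, 14`
  have hfac : ∀ c : ℝ, 0 ≤ c → (2 * (c * k)) ^ (t * k) * 2 ^ t / Λ₀ ^ t ≤ (k : ℝ) ^ t * (4 * c * Real.exp 1) ^ (k * t) := by
    intro c hc
    rw [hΛ₀, div_pow, div_div_eq_mul_div, ← pow_mul, div_le_iff₀ (by positivity)]
    -- `(2ck)^{tk} 2^t 2^{(k-1)t} ≤ k^t (4ce)^{kt} ((k-1)!)^t`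
    have hk' : ((k - 1).factorial : ℝ) * k = k.factorial := by
      rw [mul_comm]; exact_mod_cast Nat.mul_factorial_pred (by omega)
    -- per unit of `t`: `(2ck)^k · 2 · 2^{k-1} = (4ck)^k ≤ k (4ce)^k (k-1)!`
    have hunit : (2 * (c * k)) ^ k * 2 * 2 ^ (k - 1) ≤ (k : ℝ) * (4 * c * Real.exp 1) ^ k * (k - 1).factorial := by
      have h22 : (2 * (c * (k : ℝ))) ^ k * 2 * 2 ^ (k - 1) = (4 * c) ^ k * (k : ℝ) ^ k := by
        have : (2 : ℝ) * 2 ^ (k - 1) = 2 ^ k := by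
          rw [← pow_succ']; congr 1; omega
        calc (2 * (c * (k : ℝ))) ^ k * 2 * 2 ^ (k - 1) = (2 * (c * k)) ^ k * (2 * 2 ^ (k - 1)) := by ring
          _ = (2 * (c * k)) ^ k * 2 ^ k := by rw [this]
          _ = (2 * (c * k) * 2) ^ k := by rw [← mul_pow]
          _ = (4 * c * k) ^ k := by ring_nf
          _ = (4 * c) ^ k * (k : ℝ) ^ k := by rw [← mul_pow]
      rw [h22]
      have hkk := pow_self_le_exp_mul_factorial k
      calc (4 * c) ^ k * (k : ℝ) ^ k ≤ (4 * c) ^ k * (Real.exp 1 ^ k * k.factorial) :=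
            mul_le_mul_of_nonneg_left hkk (by positivity)
        _ = (4 * c * Real.exp 1) ^ k * (((k - 1).factorial : ℝ) * k) := by rw [hk', mul_pow]; ring
        _ = (k : ℝ) * (4 * c * Real.exp 1) ^ k * (k - 1).factorial := by ring
    rw [pow_mul (2 : ℝ) (k - 1) t, mul_comm t k, pow_mul (2 * (c * (k : ℝ))) k t, ← mul_pow, ← mul_pow]
    calc ((2 * (c * ↑k)) ^ k * 2 * 2 ^ (k - 1)) ^ t
        ≤ ((k : ℝ) * (4 * c * Real.exp 1) ^ k * (k - 1).factorial) ^ t :=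
          pow_le_pow_left₀ (by positivity) hunit t
      _ = (k : ℝ) ^ t * (4 * c * Real.exp 1) ^ (k * t) * ((k - 1).factorial : ℝ) ^ t := by
          rw [mul_pow, mul_pow, ← pow_mul]
  have hA := hfac 3 (by norm_num)   -- ρ + r = 3k : 2(ρ+r) = 2(3k)
  have hBt := hfac 65 (by norm_num)  -- R + r = 65k
  -- rewrite `key` in terms of these
  have e1 : (2 * (2 * (k : ℝ) + k)) = 2 * (3 * k) := by ring
  have e2 : (2 * (64 * (k : ℝ) + k)) = 2 * (65 * k) := by ring
  rw [e1, e2] at key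
  have h35 : (0 : ℝ) ≤ (1 / 21) ^ (t * k) := by positivity
  have hBf0 : 0 ≤ Bf := by
    have hz : ((64 * k : ℝ) : ℂ) ∈ Metric.sphere (0 : ℂ) (64 * k) := by
      simp
    exact (norm_nonneg _).trans (hB _ hz)
  -- first term
  have T1 : (k : ℝ) * t * ε * (2 * (3 * k)) ^ (t * k) * 2 ^ t / Λ₀ ^ t ≤
      (k : ℝ) ^ (t + 1) * t * (28 * Real.exp 1) ^ (k * t) * ε := by
    have : (k : ℝ) * t * ε * (2 * (3 * k)) ^ (t * k) * 2 ^ t / Λ₀ ^ t =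
        (k * t * ε) * ((2 * (3 * k)) ^ (t * k) * 2 ^ t / Λ₀ ^ t) := by ring
    rw [this]
    have h12 : (k : ℝ) ^ t * (4 * 3 * Real.exp 1) ^ (k * t) ≤ (k : ℝ) ^ t * (28 * Real.exp 1) ^ (k * t) := by
      apply mul_le_mul_of_nonneg_left _ (by positivity)
      apply pow_le_pow_left₀ (by positivity)
      nlinarith [Real.exp_pos 1]
    calc (k * t * ε) * ((2 * (3 * (k : ℝ))) ^ (t * k) * 2 ^ t / Λ₀ ^ t)
        ≤ (k * t * ε) * ((k : ℝ) ^ t * (28 * Real.exp 1) ^ (k * t)) :=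
          mul_le_mul_of_nonneg_left (hA.trans h12) (by positivity)
      _ = (k : ℝ) ^ (t + 1) * t * (28 * Real.exp 1) ^ (k * t) * ε := by ring
  -- second term: `(2·65k)^{tk} 2^t/Λ₀^t · (1/21)^{tk} ≤ k^t (260e/21)^{kt} ≤ k^t (28e)^{kt}`
  have T2 : (Bf + (k : ℝ) * t * ε * (2 * (65 * k)) ^ (t * k) * 2 ^ t / Λ₀ ^ t) * (1 / 21) ^ (t * k) ≤
      Bf * (1 / 21) ^ (k * t) + (k : ℝ) ^ (t + 1) * t * (28 * Real.exp 1) ^ (k * t) * ε := by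
    have hsecond : (k : ℝ) * t * ε * (2 * (65 * k)) ^ (t * k) * 2 ^ t / Λ₀ ^ t * (1 / 21) ^ (t * k) ≤
        (k : ℝ) ^ (t + 1) * t * (28 * Real.exp 1) ^ (k * t) * ε := by
      have e : (k : ℝ) * t * ε * (2 * (65 * k)) ^ (t * k) * 2 ^ t / Λ₀ ^ t * (1 / 21) ^ (t * k) =
          (k * t * ε) * (((2 * (65 * k)) ^ (t * k) * 2 ^ t / Λ₀ ^ t) * (1 / 21) ^ (t * k)) := by ring
      rw [e]
      have h1 : ((2 * (65 * (k : ℝ))) ^ (t * k) * 2 ^ t / Λ₀ ^ t) * (1 / 21) ^ (t * k) ≤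
          ((k : ℝ) ^ t * (4 * 65 * Real.exp 1) ^ (k * t)) * (1 / 21) ^ (t * k) :=
        mul_le_mul_of_nonneg_right hBt h35
      have h2 : ((k : ℝ) ^ t * (4 * 65 * Real.exp 1) ^ (k * t)) * (1 / 21) ^ (t * k) ≤
          (k : ℝ) ^ t * (28 * Real.exp 1) ^ (k * t) := by
        rw [mul_comm t k, mul_assoc, ← mul_pow]
        apply mul_le_mul_of_nonneg_left _ (by positivity)
        apply pow_le_pow_left₀ (by positivity)
        nlinarith [Real.exp_pos 1]
      calc (k * t * ε) * (((2 * (65 * (k : ℝ))) ^ (t * k) * 2 ^ t / Λ₀ ^ t) * (1 / 21) ^ (t * k))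
          ≤ (k * t * ε) * ((k : ℝ) ^ t * (28 * Real.exp 1) ^ (k * t)) :=
            mul_le_mul_of_nonneg_left (h1.trans h2) (by positivity)
        _ = (k : ℝ) ^ (t + 1) * t * (28 * Real.exp 1) ^ (k * t) * ε := by ring
    calc (Bf + (k : ℝ) * t * ε * (2 * (65 * k)) ^ (t * k) * 2 ^ t / Λ₀ ^ t) * (1 / 21) ^ (t * k)
        = Bf * (1 / 21) ^ (t * k) +
            (k : ℝ) * t * ε * (2 * (65 * k)) ^ (t * k) * 2 ^ t / Λ₀ ^ t * (1 / 21) ^ (t * k) := by ring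
      _ ≤ Bf * (1 / 21) ^ (t * k) + (k : ℝ) ^ (t + 1) * t * (28 * Real.exp 1) ^ (k * t) * ε :=
          add_le_add le_rfl hsecond
      _ = Bf * (1 / 21) ^ (k * t) + (k : ℝ) ^ (t + 1) * t * (28 * Real.exp 1) ^ (k * t) * ε := by
          rw [mul_comm k t]
  linarith [key, T1, T2]


namespace Setup

variable (S : Setup) {h Lb : ℕ}

/-! ### Lemma 3.5: the interpolation from the odd zeros below `SK` -/

set_option maxHeartbeats 800000 in
/-- **Waldschmidt 1980, Lemma 3.5 (the interpolation step), on the objects of the tree's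
Cijsouw–Waldschmidt files.** Let `p` be supported in the box of level `J` with `|p(u)| ≤ Pr`, and
suppose `φ_{J,τ''}(s') = 0` for all odd `s' < SK` (`SK ≥ 2`) and all `|τ''| < Tlo`. Let `τ` be a
multi-order with `|τ| + t ≤ Tlo` (`t ≥ 1`). With uniform bounds `Q ≥ |Qw m (w_u) 0 z|`
(`m ≤ Tlo`, `|z| ≤ 65 SK`), `G_A ≥ |A(u,τ')|` (`|τ'| ≤ Tlo`), `Ψ ≥ |ψ_u|, |ψ_u + λ_θΛ₀|`, the
smallness `⌊L_θ/2^J⌋ |Λ₀| · 65 SK ≤ x ≤ 1` and `Cl ≥ 1 + ∑|log αⱼ|`, every point `z₀` with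
`|(z₀ − 1)/2| ≤ 2⌊SK/2⌋` and `|z₀| ≤ 65 SK` satisfies `|φ_{J,τ}(z₀)| ≤ δ`,
`δ = 2 k^{t+1} t (28e)^{kt} (2Cl)^t ε₉ + B_f (3/5)^{kt} + ε₉` (`k = SK/2` nodes,
`ε₉ = N Pr Q G_A e^{65ΨSK} · 2x`, `B_f = N Pr Q G_A e^{65ΨSK}`): Hermite interpolation of
`g(w) = f_{J,τ}(2w+1)` at the integer nodes `w = i < SK/2` with `t` derivatives, plus Lemma 9.
[cite: Waldschmidt1980, Lemma 3.5 (pp. 270–272)] -/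
theorem w80_norm_Φ_le_of_odd_zeros_far
    {J₀ J : ℕ} {L : Fin S.d → ℕ} {Lθ : ℕ} {p : Idx S.d h Lb → ℤ}
    {SK Tlo t : ℕ} (hSK : 2 ≤ SK) (ht1 : 1 ≤ t)
    (hzero : ∀ s', s' < SK → Odd s' → ∀ τ'' : Tau S.d, tauNorm τ'' < Tlo →
      S.coreSum J₀ J (S.box (h := h) (Lb := Lb) L Lθ J) p τ'' s' = 0)
    (τ : Tau S.d) (hτ : tauNorm τ + t ≤ Tlo)
    {Nr : ℝ} (hNr : ((S.box (h := h) (Lb := Lb) L Lθ J).card : ℝ) ≤ Nr) (hNr1 : 1 ≤ Nr)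
    {Q GA Ψ x Cl Pr : ℝ} (hp_abs : ∀ u ∈ S.box (h := h) (Lb := Lb) L Lθ J, |(p u : ℝ)| ≤ Pr) (hPr : 1 ≤ Pr)
    (hQ : ∀ u ∈ S.box (h := h) (Lb := Lb) L Lθ J, ∀ m, m ≤ Tlo → ∀ z : ℂ, ‖z‖ ≤ 65 * (SK : ℝ) →
      ‖Qw m (S.wOf J₀ J u) 0 z‖ ≤ Q) (hQ1 : 1 ≤ Q)
    (hA : ∀ u ∈ S.box (h := h) (Lb := Lb) L Lθ J, ∀ τ' : Fin S.d → ℕ, ∑ j, τ' j ≤ Tlo → ‖S.A u τ'‖ ≤ GA)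
    (hGA1 : 1 ≤ GA)
    (hψ : ∀ u ∈ S.box (h := h) (Lb := Lb) L Lθ J, |S.ψ u| ≤ Ψ ∧ |S.expo u| ≤ Ψ) (hΨ0 : 0 ≤ Ψ)
    (hx : ((Lθ / 2 ^ J : ℕ) : ℝ) * |S.Λ₀| * (65 * (SK : ℝ)) ≤ x) (hx1 : x ≤ 1) (hx0 : 0 ≤ x)
    (hCl : 1 + ∑ j, |S.l j| ≤ Cl)
    (z₀ : ℂ) (hz₀ : ‖(z₀ - 1) / 2‖ ≤ 2 * ((SK / 2 : ℕ) : ℝ)) (hz₀' : ‖z₀‖ ≤ 65 * (SK : ℝ)) :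
    let kpts : ℕ := SK / 2
    let ε₉ : ℝ := Nr * Pr * (Q * GA * Real.exp (Ψ * (65 * (SK : ℝ)))) * (2 * x)
    let Bf : ℝ := Nr * Pr * (Q * GA * Real.exp (Ψ * (65 * (SK : ℝ))))
    ‖S.Φ J₀ J (S.box (h := h) (Lb := Lb) L Lθ J) p τ z₀‖ ≤
      2 * (kpts : ℝ) ^ (t + 1) * t * (28 * Real.exp 1) ^ (kpts * t) * ((2 * Cl) ^ t * ε₉) +
        Bf * (1 / 21) ^ (kpts * t) + ε₉ := by
  classical
  intro kpts ε₉ Bf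
  set boxJ := S.box (h := h) (Lb := Lb) L Lθ J with hboxJ
  set N : ℝ := Nr with hN
  have hkpts1 : 1 ≤ kpts := by show 1 ≤ SK / 2; omega
  have hSK2 : 2 * kpts ≤ SK := by show 2 * (SK / 2) ≤ SK; omega
  have hSKk : SK ≤ 2 * kpts + 1 := by show SK ≤ 2 * (SK / 2) + 1; omega
  -- basic facts on the box
  have hLθ : ∀ u ∈ boxJ, u.2.2 ≤ Lθ / 2 ^ J := fun u hu => (S.mem_box.mp hu).2
  have hN0' : (0 : ℝ) ≤ N := by rw [hN]; linarith
  have hcardN : ∀ {y : ℝ}, 0 ≤ y → (boxJ.card : ℝ) * Pr * y ≤ N * Pr * y := fun hy =>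
    mul_le_mul_of_nonneg_right (mul_le_mul_of_nonneg_right (by rw [hN]; exact hNr) (by linarith)) hy
  -- (1) zeros of `φ` at odd `s' < SK`
  have hzeroΦ : ∀ s', s' < SK → Odd s' → ∀ τ'' : Tau S.d, tauNorm τ'' < Tlo →
      S.Φ J₀ J boxJ p τ'' (s' : ℂ) = 0 :=
    fun s' hs' ho τ'' hτ'' => (S.Φ_natCast_eq_zero_iff J₀ J boxJ p τ'' s').mpr (hzero s' hs' ho τ'' hτ'')
  -- (2) Lemma 9 on `|z| ≤ 65 SK`
  have hL9 : ∀ τ'' : Tau S.d, tauNorm τ'' ≤ Tlo → ∀ z : ℂ, ‖z‖ ≤ 65 * (SK : ℝ) →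
      ‖S.F J₀ J boxJ p τ'' z - S.Φ J₀ J boxJ p τ'' z‖ ≤ ε₉ := by
    intro τ'' hτ'' z hz
    have h1 := S.norm_F_sub_Φ_le J₀ J boxJ p τ'' z (P := Pr) (Q := Q) (GA := GA) (Ψ := Ψ) (x := x)
      (Lθ := Lθ / 2 ^ J) hp_abs
      (fun u hu => hQ u hu τ''.1 (by unfold tauNorm at hτ''; omega) z hz)
      (fun u hu => hA u hu τ''.2 (by unfold tauNorm at hτ''; omega))
      (fun u hu => (hψ u hu).1) hLθ
      (le_trans (mul_le_mul_of_nonneg_left hz (by positivity)) hx) hx1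
    have hmono : N * Pr * (Q * GA * Real.exp (Ψ * ‖z‖)) ≤ Bf := by
      show N * Pr * (Q * GA * Real.exp (Ψ * ‖z‖)) ≤ Nr * Pr * (Q * GA * Real.exp (Ψ * (65 * (SK : ℝ))))
      rw [← hN]
      apply mul_le_mul_of_nonneg_left _ (mul_nonneg hN0' (by linarith))
      apply mul_le_mul_of_nonneg_left _ (mul_nonneg (by linarith) (by linarith))
      exact Real.exp_le_exp.mpr (mul_le_mul_of_nonneg_left hz hΨ0)
    calc ‖S.F J₀ J boxJ p τ'' z - S.Φ J₀ J boxJ p τ'' z‖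
        ≤ (boxJ.card : ℝ) * Pr * (Q * GA * Real.exp (Ψ * ‖z‖)) * (2 * x) := h1
      _ ≤ N * Pr * (Q * GA * Real.exp (Ψ * ‖z‖)) * (2 * x) :=
          mul_le_mul_of_nonneg_right (hcardN (by positivity)) (by linarith)
      _ ≤ Bf * (2 * x) := mul_le_mul_of_nonneg_right hmono (by linarith)
      _ = ε₉ := by show Bf * (2 * x) = Nr * Pr * (Q * GA * Real.exp (Ψ * (65 * (SK : ℝ)))) * (2 * x); rfl
  have hSK7 : ∀ s', s' < SK → ‖((s' : ℕ) : ℂ)‖ ≤ 65 * (SK : ℝ) := by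
    intro s' hs'
    rw [Complex.norm_natCast]
    have : (s' : ℝ) ≤ SK := by exact_mod_cast hs'.le
    have : (0 : ℝ) ≤ SK := by positivity
    linarith
  -- (3) smallness of `f` at the odd points
  have hFsmall : ∀ s', s' < SK → Odd s' → ∀ τ'' : Tau S.d, tauNorm τ'' ≤ Tlo - 1 →
      ‖S.F J₀ J boxJ p τ'' (s' : ℂ)‖ ≤ ε₉ := by
    intro s' hs' ho τ'' hτ''
    have hT1 : 1 ≤ Tlo := by omega
    have h0 := hzeroΦ s' hs' ho τ'' (by omega)
    have h1 := hL9 τ'' (by omega) (s' : ℂ) (hSK7 s' hs')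
    rwa [h0, sub_zero] at h1
  -- (4) derivatives of `f_{J,τ}` at the odd points
  set Fτ := S.F J₀ J boxJ p τ with hFτ
  have hε₉0 : 0 ≤ ε₉ := by
    show 0 ≤ Nr * Pr * (Q * GA * Real.exp (Ψ * (65 * (SK : ℝ)))) * (2 * x)
    have : 0 ≤ Pr := by linarith
    have : 0 ≤ Q := by linarith
    have : 0 ≤ GA := by linarith
    have : 0 ≤ Nr := by linarith
    positivity
  have hderiv : ∀ s', s' < SK → Odd s' → ∀ σ, σ < t →
      ‖iteratedDeriv σ Fτ (s' : ℂ)‖ ≤ (1 + ∑ j, |S.l j|) ^ σ * ε₉ := by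
    intro s' hs' ho σ hσ
    refine S.norm_iteratedDeriv_F_le_of_forall J₀ J boxJ p (s' : ℂ) (Tlo - 1)
      (fun τ'' hτ'' => hFsmall s' hs' ho τ'' hτ'') σ τ ?_
    omega
  -- (5) the function `g(z) = f_{J,τ}(2z+1)`
  set g : ℂ → ℂ := fun z => Fτ (2 * z + 1) with hg
  have hFdiff : Differentiable ℂ Fτ := S.differentiable_F J₀ J boxJ p τ
  have hg_diff : Differentiable ℂ g := hFdiff.comp (by fun_prop)
  have hg_eq : g = fun z => (fun y => Fτ (2 * y)) (z + 1 / 2) := by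
    funext z; simp only [hg]; congr 1; ring
  have hg_deriv : ∀ σ (z : ℂ), iteratedDeriv σ g z = 2 ^ σ * iteratedDeriv σ Fτ (2 * z + 1) := by
    intro σ z
    rw [hg_eq, iteratedDeriv_comp_add_const σ (fun y => Fτ (2 * y)) (1 / 2)]
    simp only
    rw [iteratedDeriv_comp_const_mul (hFdiff.contDiff) (2 : ℂ)]
    simp only
    congr 2; ring
  have hCl1 : 1 ≤ Cl := le_trans (le_add_of_nonneg_right (sum_nonneg fun j _ => abs_nonneg _)) hCl
  have hl0 : 0 ≤ 1 + ∑ j, |S.l j| := by positivity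
  set εH : ℝ := (2 * Cl) ^ t * ε₉ with hεH
  have hεH0 : 0 ≤ εH := by rw [hεH]; positivity
  have hg_small : ∀ i : ℕ, i < kpts → ∀ σ, σ < t → ‖iteratedDeriv σ g (i : ℂ)‖ ≤ εH := by
    intro i hi σ hσ
    rw [hg_deriv, norm_mul, norm_pow, Complex.norm_ofNat]
    have hodd : Odd (2 * i + 1) := ⟨i, rfl⟩
    have hlt : 2 * i + 1 < SK := by omega
    have h1 := hderiv (2 * i + 1) hlt hodd σ hσ
    have hcast : (2 : ℂ) * (i : ℂ) + 1 = (((2 * i + 1 : ℕ)) : ℂ) := by push_cast; ring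
    rw [hcast]
    calc (2 : ℝ) ^ σ * ‖iteratedDeriv σ Fτ (((2 * i + 1 : ℕ)) : ℂ)‖
        ≤ 2 ^ σ * ((1 + ∑ j, |S.l j|) ^ σ * ε₉) := mul_le_mul_of_nonneg_left h1 (by positivity)
      _ = (2 * (1 + ∑ j, |S.l j|)) ^ σ * ε₉ := by rw [mul_pow]; ring
      _ ≤ (2 * Cl) ^ σ * ε₉ := by
          apply mul_le_mul_of_nonneg_right _ hε₉0
          exact pow_le_pow_left₀ (by positivity) (by linarith) σ
      _ ≤ (2 * Cl) ^ t * ε₉ := by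
          apply mul_le_mul_of_nonneg_right _ hε₉0
          exact pow_le_pow_right₀ (by linarith) hσ.le
  -- the growth of `g` on `|z| = 6 kpts`
  have hg_bound : ∀ z ∈ Metric.sphere (0 : ℂ) (64 * kpts), ‖g z‖ ≤ Bf := by
    intro z hz
    have hz' : ‖z‖ = 64 * kpts := by simpa using hz
    have h2z : ‖2 * z + 1‖ ≤ 65 * (SK : ℝ) := by
      calc ‖2 * z + 1‖ ≤ ‖2 * z‖ + ‖(1 : ℂ)‖ := norm_add_le _ _
        _ = 2 * (64 * kpts) + 1 := by rw [norm_mul, Complex.norm_ofNat, hz', norm_one]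
        _ ≤ 65 * SK := by
            have : (2 * kpts : ℝ) ≤ SK := by exact_mod_cast hSK2
            have : (1 : ℝ) ≤ SK := by exact_mod_cast (by omega : 1 ≤ SK)
            linarith
    simp only [hg]
    have h1 := S.norm_F_le J₀ J boxJ p τ (2 * z + 1) (P := Pr) (Q := Q) (GA := GA) (Ψ := Ψ) hp_abs
      (fun u hu => hQ u hu τ.1 (by unfold tauNorm at hτ; omega) _ h2z)
      (fun u hu => hA u hu τ.2 (by unfold tauNorm at hτ; omega))
      (fun u hu => (hψ u hu).2)
    calc ‖S.F J₀ J boxJ p τ (2 * z + 1)‖ ≤ (boxJ.card : ℝ) * Pr * (Q * GA * Real.exp (Ψ * ‖2 * z + 1‖)) := h1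
      _ ≤ N * Pr * (Q * GA * Real.exp (Ψ * ‖2 * z + 1‖)) := hcardN (by positivity)
      _ ≤ Bf := by
          show N * Pr * (Q * GA * Real.exp (Ψ * ‖2 * z + 1‖)) ≤ Nr * Pr * (Q * GA * Real.exp (Ψ * (65 * (SK : ℝ))))
          rw [← hN]
          apply mul_le_mul_of_nonneg_left _ (mul_nonneg hN0' (by linarith))
          apply mul_le_mul_of_nonneg_left _ (mul_nonneg (by linarith) (by linarith))
          exact Real.exp_le_exp.mpr (mul_le_mul_of_nonneg_left h2z hΨ0)
  -- (6) Hermite at `w₀ = (z₀ − 1)/2`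
  set w₀ : ℂ := (z₀ - 1) / 2 with hw₀
  have hw₀2 : 2 * w₀ + 1 = z₀ := by rw [hw₀]; ring
  have hw₀n : ‖w₀‖ ≤ 2 * kpts := by rw [hw₀]; exact hz₀
  have hH := hermite_integer_points_far hg_diff hkpts1 ht1 hεH0 hg_small hg_bound hw₀n
  have hFval : ‖Fτ z₀‖ ≤ 2 * (kpts : ℝ) ^ (t + 1) * t * (28 * Real.exp 1) ^ (kpts * t) * εH +
      Bf * (1 / 21) ^ (kpts * t) := by
    have : g w₀ = Fτ z₀ := by simp only [hg]; rw [hw₀2]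
    rw [← this]; exact hH
  -- (7) Lemma 9 at `z₀`
  have h1 := hL9 τ (by omega) z₀ hz₀'
  have h2 : ‖S.Φ J₀ J boxJ p τ z₀‖ ≤ ‖Fτ z₀‖ + ‖Fτ z₀ - S.Φ J₀ J boxJ p τ z₀‖ := by
    have := norm_sub_le (Fτ z₀) (Fτ z₀ - S.Φ J₀ J boxJ p τ z₀)
    rwa [sub_sub_cancel] at this
  rw [hεH] at hFval
  linarith

/-! ### Lemma 3.6: one step of the extrapolation in `k` -/

/-- **Waldschmidt 1980, Lemma 3.6 (one step `k → k+1` of the extrapolation).** Under the hypotheses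
of `w80_norm_Φ_le_of_odd_zeros_far` (zeros at the odd `s' < SK`, `SK ≥ 2` even, for `|τ''| < Tlo`),
if moreover the denominators `D_J(s₁, τ)` of the integer points `s₁ < 2·SK` are `≤ Dmax` and
`δ < 1/Dmax`, then `φ_{J,τ}(s₁) = 0` for ALL odd `s₁ < 2·SK` and all `τ` with `|τ| + t ≤ Tlo`
("finally, Lemma 3.4 and (3.16), (3.21) enable us to conclude that the considered numbers
`φ_{J,τ}(s)` vanish", p. 272). [cite: Waldschmidt1980, Lemma 3.6 (p. 272)] -/
theorem w80_kstep_far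
    {J₀ J : ℕ} {L : Fin S.d → ℕ} {Lθ : ℕ} {p : Idx S.d h Lb → ℤ}
    {SK Tlo t : ℕ} (hSK : 2 ≤ SK) (hSKe : Even SK) (ht1 : 1 ≤ t)
    (hzero : ∀ s', s' < SK → Odd s' → ∀ τ'' : Tau S.d, tauNorm τ'' < Tlo →
      S.coreSum J₀ J (S.box (h := h) (Lb := Lb) L Lθ J) p τ'' s' = 0)
    {Nr : ℝ} (hNr : ((S.box (h := h) (Lb := Lb) L Lθ J).card : ℝ) ≤ Nr) (hNr1 : 1 ≤ Nr)
    {Q GA Ψ x Cl Pr Dmax : ℝ} (hp_abs : ∀ u ∈ S.box (h := h) (Lb := Lb) L Lθ J, |(p u : ℝ)| ≤ Pr)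
    (hPr : 1 ≤ Pr)
    (hQ : ∀ u ∈ S.box (h := h) (Lb := Lb) L Lθ J, ∀ m, m ≤ Tlo → ∀ z : ℂ, ‖z‖ ≤ 65 * (SK : ℝ) →
      ‖Qw m (S.wOf J₀ J u) 0 z‖ ≤ Q) (hQ1 : 1 ≤ Q)
    (hA : ∀ u ∈ S.box (h := h) (Lb := Lb) L Lθ J, ∀ τ' : Fin S.d → ℕ, ∑ j, τ' j ≤ Tlo → ‖S.A u τ'‖ ≤ GA)
    (hGA1 : 1 ≤ GA)
    (hψ : ∀ u ∈ S.box (h := h) (Lb := Lb) L Lθ J, |S.ψ u| ≤ Ψ ∧ |S.expo u| ≤ Ψ) (hΨ0 : 0 ≤ Ψ)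
    (hx : ((Lθ / 2 ^ J : ℕ) : ℝ) * |S.Λ₀| * (65 * (SK : ℝ)) ≤ x) (hx1 : x ≤ 1) (hx0 : 0 ≤ x)
    (hCl : 1 + ∑ j, |S.l j| ≤ Cl)
    (hD : ∀ τ : Tau S.d, tauNorm τ + t ≤ Tlo → ∀ s₁, s₁ < 2 * SK →
      ((S.DclearJ (h := h) J₀ J L Lθ s₁ τ : ℕ) : ℝ) ≤ Dmax)
    (hfinal :
      let kpts : ℕ := SK / 2
      let ε₉ : ℝ := Nr * Pr * (Q * GA * Real.exp (Ψ * (65 * (SK : ℝ)))) * (2 * x)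
      let Bf : ℝ := Nr * Pr * (Q * GA * Real.exp (Ψ * (65 * (SK : ℝ))))
      2 * (kpts : ℝ) ^ (t + 1) * t * (28 * Real.exp 1) ^ (kpts * t) * ((2 * Cl) ^ t * ε₉) +
        Bf * (1 / 21) ^ (kpts * t) + ε₉ < 1 / Dmax) :
    ∀ s₁, s₁ < 2 * SK → Odd s₁ → ∀ τ : Tau S.d, tauNorm τ + t ≤ Tlo →
      S.coreSum J₀ J (S.box (h := h) (Lb := Lb) L Lθ J) p τ s₁ = 0 := by
  intro s₁ hs₁ hodd τ hτ
  -- the point `z₀ = s₁`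
  have hz₀ : ‖(((s₁ : ℕ) : ℂ) - 1) / 2‖ ≤ 2 * ((SK / 2 : ℕ) : ℝ) := by
    obtain ⟨i, rfl⟩ := hodd
    have heven : 2 * (SK / 2) = SK := Nat.two_mul_div_two_of_even hSKe
    have hcast : (((2 * i + 1 : ℕ) : ℂ) - 1) / 2 = ((i : ℕ) : ℂ) := by push_cast; ring
    rw [hcast, Complex.norm_natCast]
    have : i + 1 ≤ SK := by omega
    have : (i : ℝ) ≤ 2 * ((SK / 2 : ℕ) : ℝ) := by exact_mod_cast (by omega : i ≤ 2 * (SK / 2))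
    exact this
  have hz₀' : ‖((s₁ : ℕ) : ℂ)‖ ≤ 65 * (SK : ℝ) := by
    rw [Complex.norm_natCast]
    have : (s₁ : ℝ) ≤ 2 * SK := by exact_mod_cast hs₁.le
    have : (0 : ℝ) ≤ SK := by positivity
    linarith
  have hΦ := S.w80_norm_Φ_le_of_odd_zeros_far hSK ht1 hzero τ hτ hNr hNr1 hp_abs hPr hQ hQ1 hA hGA1 hψ hΨ0
    hx hx1 hx0 hCl ((s₁ : ℕ) : ℂ) hz₀ hz₀'
  refine S.coreSum_eq_zero_of_abs_lt J₀ J L Lθ p τ s₁ (hD τ hτ s₁ hs₁) ?_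
  have hnorm : ‖S.Φ J₀ J (S.box (h := h) (Lb := Lb) L Lθ J) p τ ((s₁ : ℕ) : ℂ)‖ =
      |(S.coreSum J₀ J (S.box (h := h) (Lb := Lb) L Lθ J) p τ s₁ : ℝ)| := by
    rw [S.Φ_natCast, ← Complex.ofReal_ratCast, Complex.norm_real, Real.norm_eq_abs]
  rw [← hnorm]
  exact lt_of_le_of_lt hΦ hfinal

/-! ### Lemma 3.7 and (3.22): the half points -/

set_option maxHeartbeats 800000 in
/-- **Waldschmidt 1980, Lemma 3.7 with the sharp Liouville estimate (3.22).** Under the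
hypotheses of `w80_norm_Φ_le_of_odd_zeros_far` at level `J < J₀` with `2^J S₀ ≤ SK` (zeros at the odd
`s' < SK`, `|τ''| < Tlo`), the `2`-Kummer condition, bounds `Rmax ≥ |rHalf|` and `Dmax ≥ Dhalf`
at the half points `s/2`, `s < 2^{J+1} S₀`, and the final inequality
`δ < M/(4 Dmax M (∏ H(αᵢ))²)^{2^{d+1}}`, `M = N Pr Rmax` (sharp Liouville,
`Waldschmidt1980.abs_ev_ge_sharp`, against the smallness `δ` of Lemma 3.5), we get
`φ_{J,τ}(s/2) = 0` for all odd `s < 2^{J+1} S₀` and `|τ| + t ≤ Tlo` ("Using Lemma 3.3 and (3.16),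
(3.22) once more, we deduce Lemma 3.7", p. 272) — the hypothesis `half` of
`CW77.Setup.descent_algebra` as soon as `T/2^{J+1} + t ≤ Tlo`. [cite: Waldschmidt1980, Lemma 3.7 (p. 272)] -/
theorem w80_halfstep_far
    (hind : ∀ T : Finset (Fin (S.d + 1)), T.Nonempty → ¬ IsSquare (∏ i ∈ T, S.all i))
    {J₀ J : ℕ} (hJ : J < J₀) {L : Fin S.d → ℕ} {Lθ S₀ : ℕ} {p : Idx S.d h Lb → ℤ}
    {SK Tlo t : ℕ} (hSK : 2 ≤ SK) (hSKS : 2 ^ J * S₀ ≤ SK) (ht1 : 1 ≤ t)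
    (hzero : ∀ s', s' < SK → Odd s' → ∀ τ'' : Tau S.d, tauNorm τ'' < Tlo →
      S.coreSum J₀ J (S.box (h := h) (Lb := Lb) L Lθ J) p τ'' s' = 0)
    {Nr : ℝ} (hNr : ((S.box (h := h) (Lb := Lb) L Lθ J).card : ℝ) ≤ Nr) (hNr1 : 1 ≤ Nr)
    {Q GA Ψ x Cl Pr Rmax Dmax : ℝ} (hp_abs : ∀ u ∈ S.box (h := h) (Lb := Lb) L Lθ J, |(p u : ℝ)| ≤ Pr)
    (hPr : 1 ≤ Pr)
    (hQ : ∀ u ∈ S.box (h := h) (Lb := Lb) L Lθ J, ∀ m, m ≤ Tlo → ∀ z : ℂ, ‖z‖ ≤ 65 * (SK : ℝ) →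
      ‖Qw m (S.wOf J₀ J u) 0 z‖ ≤ Q) (hQ1 : 1 ≤ Q)
    (hA : ∀ u ∈ S.box (h := h) (Lb := Lb) L Lθ J, ∀ τ' : Fin S.d → ℕ, ∑ j, τ' j ≤ Tlo → ‖S.A u τ'‖ ≤ GA)
    (hGA1 : 1 ≤ GA)
    (hψ : ∀ u ∈ S.box (h := h) (Lb := Lb) L Lθ J, |S.ψ u| ≤ Ψ ∧ |S.expo u| ≤ Ψ) (hΨ0 : 0 ≤ Ψ)
    (hx : ((Lθ / 2 ^ J : ℕ) : ℝ) * |S.Λ₀| * (65 * (SK : ℝ)) ≤ x) (hx1 : x ≤ 1) (hx0 : 0 ≤ x)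
    (hCl : 1 + ∑ j, |S.l j| ≤ Cl)
    (hR : ∀ u ∈ S.box (h := h) (Lb := Lb) L Lθ J, ∀ τ : Tau S.d, tauNorm τ + t ≤ Tlo →
      ∀ s, s < 2 ^ (J + 1) * S₀ → |(S.rHalf J₀ J u τ s : ℝ)| ≤ Rmax) (hR1 : 1 ≤ Rmax)
    (hD : ∀ τ : Tau S.d, tauNorm τ + t ≤ Tlo → ∀ s, s < 2 ^ (J + 1) * S₀ →
      ((S.Dhalf (h := h) J₀ J L Lθ s τ : ℕ) : ℝ) ≤ Dmax)
    (hfinal :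
      let kpts : ℕ := SK / 2
      let ε₉ : ℝ := Nr * Pr * (Q * GA * Real.exp (Ψ * (65 * (SK : ℝ)))) * (2 * x)
      let Bf : ℝ := Nr * Pr * (Q * GA * Real.exp (Ψ * (65 * (SK : ℝ))))
      2 * (kpts : ℝ) ^ (t + 1) * t * (28 * Real.exp 1) ^ (kpts * t) * ((2 * Cl) ^ t * ε₉) +
        Bf * (1 / 21) ^ (kpts * t) + ε₉ <
          (Nr * Pr * Rmax) / (4 * Dmax * (Nr * Pr * Rmax) * heightProd S.all ^ 2) ^ (2 ^ (S.d + 1))) :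
    ∀ s, s < 2 ^ (J + 1) * S₀ → Odd s → ∀ τ : Tau S.d, tauNorm τ + t ≤ Tlo →
      S.Φ J₀ J (S.box (h := h) (Lb := Lb) L Lθ J) p τ ((s : ℂ) / 2) = 0 := by
  classical
  intro s hs hodd τ hτ
  set boxJ := S.box (h := h) (Lb := Lb) L Lθ J with hboxJ
  -- the point `z₀ = s/2`
  have hsSK : s < 2 * SK := by
    have : 2 ^ (J + 1) * S₀ = 2 * (2 ^ J * S₀) := by ring
    omega
  have hz₀ : ‖((s : ℂ) / 2 - 1) / 2‖ ≤ 2 * ((SK / 2 : ℕ) : ℝ) := by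
    have h1 : ‖(s : ℂ) / 2 - 1‖ ≤ (s : ℝ) / 2 + 1 := by
      calc ‖(s : ℂ) / 2 - 1‖ ≤ ‖(s : ℂ) / 2‖ + ‖(1 : ℂ)‖ := norm_sub_le _ _
        _ = (s : ℝ) / 2 + 1 := by rw [norm_div, Complex.norm_natCast, Complex.norm_ofNat, norm_one]
    rw [norm_div, Complex.norm_ofNat, div_le_iff₀ (by norm_num : (0:ℝ) < 2)]
    have hs' : (s : ℝ) + 1 ≤ 2 * SK := by exact_mod_cast (by omega : s + 1 ≤ 2 * SK)
    have hk : (SK : ℝ) ≤ 2 * ((SK / 2 : ℕ) : ℝ) + 1 := by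
      exact_mod_cast (by omega : SK ≤ 2 * (SK / 2) + 1)
    have hk1 : (1 : ℝ) ≤ ((SK / 2 : ℕ) : ℝ) := by exact_mod_cast (show 1 ≤ SK / 2 by omega)
    linarith
  have hz₀' : ‖(s : ℂ) / 2‖ ≤ 65 * (SK : ℝ) := by
    rw [norm_div, Complex.norm_natCast, Complex.norm_ofNat, div_le_iff₀ (by norm_num : (0:ℝ) < 2)]
    have : (s : ℝ) ≤ 2 * SK := by exact_mod_cast hsSK.le
    have : (0 : ℝ) ≤ SK := by positivity
    linarith
  have hΦval := S.w80_norm_Φ_le_of_odd_zeros_far hSK ht1 hzero τ hτ hNr hNr1 hp_abs hPr hQ hQ1 hA hGA1 hψ hΨ0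
    hx hx1 hx0 hCl ((s : ℂ) / 2) hz₀ hz₀'
  set δ : ℝ := 2 * ((SK / 2 : ℕ) : ℝ) ^ (t + 1) * t * (28 * Real.exp 1) ^ ((SK / 2) * t) *
      ((2 * Cl) ^ t * (Nr * Pr * (Q * GA * Real.exp (Ψ * (65 * (SK : ℝ)))) * (2 * x))) +
      Nr * Pr * (Q * GA * Real.exp (Ψ * (65 * (SK : ℝ)))) * (1 / 21) ^ ((SK / 2) * t) +
      Nr * Pr * (Q * GA * Real.exp (Ψ * (65 * (SK : ℝ)))) * (2 * x) with hδ
  have hΦδ : ‖S.Φ J₀ J boxJ p τ ((s : ℂ) / 2)‖ ≤ δ := hΦval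
  -- Liouville
  by_cases hcv : S.classVec J₀ J boxJ p τ s = 0
  · rw [S.Φ_half hJ, hcv, ev_zero]; simp
  · exfalso
    set D : ℕ := S.Dhalf (h := h) J₀ J L Lθ s τ with hDdef
    have hD1 : 1 ≤ D := S.Dhalf_pos J₀ J L Lθ s τ
    set M : ℝ := Nr * Pr * Rmax with hM
    have hN0 : (0 : ℝ) ≤ Nr := by linarith
    have hM1 : 1 ≤ M := by
      rw [hM]
      have h1 : (1 : ℝ) ≤ Nr * Pr := by nlinarith
      nlinarith
    have hM0 : 0 < M := by linarith
    have hp_abs' : ∀ u ∈ boxJ, |(p u : ℝ)| ≤ Pr := hp_abs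
    have hcardN : (boxJ.card : ℝ) * Pr * Rmax ≤ M := by
      rw [hM]
      exact mul_le_mul_of_nonneg_right (mul_le_mul_of_nonneg_right hNr (by linarith)) (by linarith)
    have hcM : ∑ T', |(S.classVec J₀ J boxJ p τ s T' : ℝ)| ≤ M := by
      refine (S.sum_abs_classVec_le J₀ J boxJ p τ s).trans ?_
      calc ∑ u ∈ boxJ, |(p u : ℝ)| * |(S.rHalf J₀ J u τ s : ℝ)| ≤ ∑ _u ∈ boxJ, Pr * Rmax :=
            sum_le_sum fun u hu => mul_le_mul (hp_abs' u hu) (hR u hu τ hτ s hs) (abs_nonneg _) (by linarith)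
        _ = (boxJ.card : ℝ) * Pr * Rmax := by rw [sum_const, nsmul_eq_mul]; ring
        _ ≤ M := hcardN
    have hliou := Waldschmidt1980.abs_ev_ge_sharp (S.d + 1) S.all S.all_pos hind _ hcv D hD1
      (S.exists_int_Dhalf_mul_classVec J₀ J L Lθ τ s) M hM1 hcM
    -- the smallness of `|ev|`
    have hev_le : |ev S.all (S.classVec J₀ J boxJ p τ s)| ≤ δ := by
      have hfac := S.Φ_half hJ boxJ p τ s
      have hnorm : ‖S.Φ J₀ J boxJ p τ ((s : ℂ) / 2)‖ =
          2 ^ τ.1 * |ev S.all (S.classVec J₀ J boxJ p τ s)| := by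
        rw [hfac, norm_mul, norm_pow, Complex.norm_ofNat, Complex.norm_real, Real.norm_eq_abs]
      have h2 : (1 : ℝ) ≤ 2 ^ τ.1 := one_le_pow₀ (by norm_num)
      calc |ev S.all (S.classVec J₀ J boxJ p τ s)|
          = 1 * |ev S.all (S.classVec J₀ J boxJ p τ s)| := (one_mul _).symm
        _ ≤ 2 ^ τ.1 * |ev S.all (S.classVec J₀ J boxJ p τ s)| :=
            mul_le_mul_of_nonneg_right h2 (abs_nonneg _)
        _ = ‖S.Φ J₀ J boxJ p τ ((s : ℂ) / 2)‖ := hnorm.symm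
        _ ≤ δ := hΦδ
    -- comparing with `hfinal`: the Liouville bound is monotone in `D ≤ Dmax`
    have hDle : (D : ℝ) ≤ Dmax := hD τ hτ s hs
    have hPht : 1 ≤ heightProd S.all := one_le_heightProd _
    have hD0 : (0 : ℝ) < D := by exact_mod_cast hD1
    have hbase : 0 < 4 * (D : ℝ) * M * heightProd S.all ^ 2 := by positivity
    have hmono : M / (4 * Dmax * M * heightProd S.all ^ 2) ^ (2 ^ (S.d + 1)) ≤
        M / (4 * (D : ℝ) * M * heightProd S.all ^ 2) ^ (2 ^ (S.d + 1)) := by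
      apply div_le_div_of_nonneg_left hM0.le (pow_pos hbase _)
      apply pow_le_pow_left₀ hbase.le
      have : 0 ≤ M * heightProd S.all ^ 2 := by positivity
      nlinarith
    have hfin : δ < M / (4 * Dmax * M * heightProd S.all ^ 2) ^ (2 ^ (S.d + 1)) := by
      rw [hM, hδ]; exact hfinal
    linarith [hliou, hev_le, hmono, hfin]

end Setup

end Literature.NumberTheory.Transcendental.CW77

end
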